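import Summits.QuantumFields.YangMills.Theorems.LuscherReductionDressedRitzPolyakovLiftGramUniversality
import Summits.QuantumFields.YangMills.Theorems.LuscherReductionDressedRitzPolyakovLiftSlabChannelUniversality
import HarnessLib

/-!
# Route `LuscherReduction`, item `DressedRitz` (stmt-QuantumFields-20205), line «polyakovlift» r5, stub S-STAT — the RG core (A2) `GramUniversalityAt` in
# EUCLIDEAN ∕ FINITE-SLAB currency: `SlabGramUniversalityAt k → EuclideanGramUniversalityAt k → GramUniversalityAt k`

Support module (seat ym-infvol-p1 g6, holder of S-STAT `stub_liftStatics`; `--supports stmt-QuantumFields-20205`, helper).  In the crux map of record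
(`CRUX-MAP-r5.md`) the open RG cores of the line form ONE statement family «flowed-Polyakov channel correlators on `L³ × T` at separations `2L, 2L+1, 2L+2`
= their one-site shadows' to relative `O(λ)` (amplitude) ∕ `O(λ²/L)` (energy)», and the LEAD has re-expressed the S-UNIV′ core in the currency an RG ∕
cluster expansion actually computes — normalised connected correlators `corr` (`…EuclideanCurrency.lean`, p537143) and finite free-boundary SLAB RATIOS
`slabCorr … M` (`…SlabChannelUniversality.lean`, p540780; dictionary `tendsto_corr`, p538750).  This file does the same for S-STAT's RG core (A2)
(`GramUniversalityAt`, `…PolyakovLiftGramUniversality.lean`, p536411), the time-`2L` member of the family: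

* `EuclideanGramUniversalityAt k` — (E2): `|cF_{2m,il}·√(cO_{2m,ii} cO_{2m,ll}) − cO_{2m,il}·√(cF_{2m,ii} cF_{2m,ll})| ≤ Cλ·√(cF cF)·√(cO cO)`, `m = L`
  (fine vs one-site-shadow CORRELATION COEFFICIENTS at separation `2L` agree to `O(λ)`; no powers of the top values);
* ★ `gramUniversality_of_euclidean : EuclideanGramUniversalityAt k → GramUniversalityAt k` (the dressed Gram numbers are `λ₀^{2L}·cF_{2L}` ∕ `μ₀^{2L}·cO_{2L}`,
  `corr_dressed_norm`; the clause scales by the positive factor `(λ₀μ₀)^{2L}`; same `C`, same `lam0`);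
* `SlabGramUniversalityAt k` — (E2) with `slabCorr … M` for all slab parameters `M ≥ M₀`;
* ★ `euclideanGramUniversality_of_slab` (limit `M → ∞`, `tendsto_slabCorr`; `L0` raised to `≥ 1`) and ★ `gramUniversality_of_slab`.

So S-STAT's RG half reads: a statement about RATIOS OF FINITE free-boundary slab path integrals with two flowed-Polyakov insertions `2L` transfer steps
apart, versus the same ratios in the one-site `B`-model — the input format of a Bałaban-type small-field expansion.  HONEST FRAMING: currency change
(pure-real and limit plumbing) on the conditional femto rung R2b1; (E2) is the OPEN renormalisation-group estimate; nothing here bears on infinite volume,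
the continuum limit or the Clay gap.  References: M. Lüscher, U. Wolff, NPB 339 (1990) 222 [cite: LuscherWolff1990]; E. Seiler, LNP 159 (1982), §3
[cite: SeilerLNP1982, §3]; M. Lüscher, NPB 219 (1983) 233 [cite: Luscher1983, §3].
-/

set_option autoImplicit false

noncomputable section

open MeasureTheory Filter Topology Real
open Literature.MathematicalPhysics.QuantumFieldTheory (GaugeConfig Site gaugeTransform)
open scoped BigOperators

namespace Summit.QuantumFields.YangMills.Theorems.FemtoTransferGap.PolyakovLift

open Summit.QuantumFields.YangMills.Theorems.FemtoTransferGap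

/-! ## §1 (A2) in Euclidean currency -/

/-- **`EuclideanGramUniversalityAt k`** — (E2): deep in the femto window, for every lift basis and all raw vacua, with the fine correlators
`cF = corr β φ (flowLiftAt 0 (flowTime β L) ∘ g)` and the one-site shadow correlators `cO = corr B e₀ (g · ∘ powLink L)` at separation `2m`, `m = dressSteps L`:
`|cF_{2m,il}·√(cO_{2m,ii} cO_{2m,ll}) − cO_{2m,il}·√(cF_{2m,ii} cF_{2m,ll})| ≤ Cλ·√(cF_{2m,ii} cF_{2m,ll})·√(cO_{2m,ii} cO_{2m,ll})` (`i ≠ l`). [cite: LuscherWolff1990] -/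
def EuclideanGramUniversalityAt (k : ℕ) : Prop :=
  ∃ C lam0 : ℝ, 0 ≤ C ∧ 0 < lam0 ∧ ∀ lam : ℝ, 0 < lam → lam ≤ lam0 → ∃ L0 : ℕ,
    ∀ (L : ℕ) [NeZero L], L0 ≤ L → ∀ β : ℝ, InFemtoWindow lam β L →
      ∀ φ : GaugeConfig 3 L SU2 → ℝ, IsRawVacuum β φ →
        ∀ (ω : GaugeConfig 3 1 SU2 → ℝ) (g : Fin k → (GaugeConfig 3 1 SU2 → ℝ)), LiftBasis (liftCoupling β L) k ω g →
          ∀ e₀ : GaugeConfig 3 1 SU2 → ℝ, IsRawVacuum (L := 1) (oneSiteCoupling β L) e₀ →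
            let cF := corr β φ (fun i => flowLiftAt (L := L) 0 (flowTime β L) (g i))
            let cO := corr (oneSiteCoupling β L) e₀ (fun i => g i ∘ powLink L)
            let m := dressSteps L
            ∀ i l : Fin k, i ≠ l →
              |cF (2 * m) i l * (Real.sqrt (cO (2 * m) i i) * Real.sqrt (cO (2 * m) l l)) -
                  cO (2 * m) i l * (Real.sqrt (cF (2 * m) i i) * Real.sqrt (cF (2 * m) l l))|
                ≤ C * luscherLambda β L *
                    (Real.sqrt (cF (2 * m) i i) * Real.sqrt (cF (2 * m) l l)) * (Real.sqrt (cO (2 * m) i i) * Real.sqrt (cO (2 * m) l l))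

/-! ## §2 ★ Euclidean ⟹ channel form -/

/-- ★★ **`EuclideanGramUniversalityAt k → GramUniversalityAt k`**: the dressed Gram numbers are `λ₀^{2m}·cF(2m)` ∕ `μ₀^{2m}·cO(2m)` (`corr_dressed_norm` on both
sides), so the clause of `GramUniversalityAt` is (E2) times the positive factor `λ₀^{2m}μ₀^{2m}` (same `C`, same `lam0`). [cite: LuscherWolff1990] -/
theorem gramUniversality_of_euclidean {k : ℕ} (h : EuclideanGramUniversalityAt k) : GramUniversalityAt k := by
  obtain ⟨C, lam0, hC, hlam0, hk⟩ := h
  refine ⟨C, lam0, hC, hlam0, fun lam hlam hle => ?_⟩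
  obtain ⟨L0, hL⟩ := hk lam hlam hle
  refine ⟨L0, fun L _ hL0 β hW φ hφ ω g hbasis e₀ he₀ i l hil => ?_⟩
  have e := hL L hL0 β hW φ hφ ω g hbasis e₀ he₀ i l hil
  -- positivity facts
  have hβ : 0 < β := zero_lt_one.trans_le hW.1
  have hΛpos : 0 < luscherLambda β L := luscherLambda_pos_of_window hlam hW
  have hLpos : (0 : ℝ) < L := Nat.cast_pos.mpr (NeZero.pos L)
  have hBpos : 0 < oneSiteCoupling β L := by
    unfold oneSiteCoupling; exact div_pos (mul_pos two_pos (pow_pos hLpos 3)) (pow_pos hΛpos 3)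
  set l0 := levelValue su2Rep L β 0 with hl0
  set m0 := levelValue su2Rep 1 (oneSiteCoupling β L) 0 with hm0
  have hl0pos : 0 < l0 := levelValue_su2Rep_pos hβ 0
  have hm0pos : 0 < m0 := levelValue_su2Rep_pos (L := 1) hBpos 0
  set m := dressSteps L with hm
  set G : Fin k → (GaugeConfig 3 L SU2 → ℝ) := fun i => flowLiftAt (L := L) 0 (flowTime β L) (g i) with hG
  set S : Fin k → (GaugeConfig 3 1 SU2 → ℝ) := fun i => g i ∘ powLink L with hS
  set cF := corr β φ G with hcF
  set cO := corr (oneSiteCoupling β L) e₀ S with hcO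
  have hg : ∀ i, IsPhys (g i) := hbasis.2.2.2.2.1
  have hGi : ∀ i, IsPhys (G i) := fun i => isPhys_flowLiftAt 0 _ (hg i)
  have hSi : ∀ i, IsPhys (S i) := fun i => isPhys_comp_powLink L (hg i)
  -- the dictionary
  have hnF : ∀ i l : Fin k, l2 (dressedLiftFamily β φ g i) (dressedLiftFamily β φ g l) = l0 ^ (2 * m) * cF (2 * m) i l := fun i l => by
    simp only [dressedLiftFamily_apply]
    exact corr_dressed_norm hβ hφ.1 hGi m i l
  have hnO : ∀ i l : Fin k, l2 (shadowFamily (oneSiteCoupling β L) L e₀ g i) (shadowFamily (oneSiteCoupling β L) L e₀ g l) =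
      m0 ^ (2 * m) * cO (2 * m) i l := fun i l => by
    simp only [shadowFamily, shadowVec]
    exact corr_dressed_norm hBpos he₀.1 hSi m i l
  have hsF : ∀ i : Fin k, Real.sqrt (l2 (dressedLiftFamily β φ g i) (dressedLiftFamily β φ g i)) = l0 ^ m * Real.sqrt (cF (2 * m) i i) :=
    fun i => by rw [hnF, sqrt_pow_two_mul_mul hl0pos.le]
  have hsO : ∀ i : Fin k, Real.sqrt (l2 (shadowFamily (oneSiteCoupling β L) L e₀ g i) (shadowFamily (oneSiteCoupling β L) L e₀ g i)) =
      m0 ^ m * Real.sqrt (cO (2 * m) i i) := fun i => by rw [hnO, sqrt_pow_two_mul_mul hm0pos.le]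
  have hP : 0 < l0 ^ (2 * m) * m0 ^ (2 * m) := mul_pos (pow_pos hl0pos _) (pow_pos hm0pos _)
  have hP2 : l0 ^ (2 * m) * m0 ^ (2 * m) = (l0 ^ m * l0 ^ m) * (m0 ^ m * m0 ^ m) := by
    rw [← pow_add, ← pow_add]; ring_nf
  set sF := Real.sqrt (cF (2 * m) i i) * Real.sqrt (cF (2 * m) l l) with hsFd
  set sO := Real.sqrt (cO (2 * m) i i) * Real.sqrt (cO (2 * m) l l) with hsOd
  rw [hsF i, hsF l, hsO i, hsO l, hnF i l, hnO i l]
  have hlhs : l0 ^ (2 * m) * cF (2 * m) i l * (m0 ^ m * Real.sqrt (cO (2 * m) i i) * (m0 ^ m * Real.sqrt (cO (2 * m) l l))) -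
        m0 ^ (2 * m) * cO (2 * m) i l * (l0 ^ m * Real.sqrt (cF (2 * m) i i) * (l0 ^ m * Real.sqrt (cF (2 * m) l l)))
      = (l0 ^ (2 * m) * m0 ^ (2 * m)) * (cF (2 * m) i l * sO - cO (2 * m) i l * sF) := by
    rw [hsFd, hsOd, hP2]; ring
  have hrhs : C * luscherLambda β L * (l0 ^ m * Real.sqrt (cF (2 * m) i i) * (l0 ^ m * Real.sqrt (cF (2 * m) l l))) *
        (m0 ^ m * Real.sqrt (cO (2 * m) i i) * (m0 ^ m * Real.sqrt (cO (2 * m) l l)))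
      = (l0 ^ (2 * m) * m0 ^ (2 * m)) * (C * luscherLambda β L * sF * sO) := by
    rw [hsFd, hsOd, hP2]; ring
  rw [hlhs, hrhs, abs_mul, abs_of_pos hP]
  exact mul_le_mul_of_nonneg_left e hP.le

/-! ## §3 (A2) for finite slabs, and the limit -/

/-- **`SlabGramUniversalityAt k`** — (E2) with every normalised connected correlator replaced by the finite free-boundary slab ratio `slabCorr … M`,
asserted for all slab parameters `M ≥ M₀`. [cite: SeilerLNP1982, §3] [cite: LuscherWolff1990] -/
def SlabGramUniversalityAt (k : ℕ) : Prop :=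
  ∃ C lam0 : ℝ, 0 ≤ C ∧ 0 < lam0 ∧ ∀ lam : ℝ, 0 < lam → lam ≤ lam0 → ∃ L0 : ℕ,
    ∀ (L : ℕ) [NeZero L], L0 ≤ L → ∀ β : ℝ, InFemtoWindow lam β L →
      ∀ φ : GaugeConfig 3 L SU2 → ℝ, IsRawVacuum β φ →
        ∀ (ω : GaugeConfig 3 1 SU2 → ℝ) (g : Fin k → (GaugeConfig 3 1 SU2 → ℝ)), LiftBasis (liftCoupling β L) k ω g →
          ∀ e₀ : GaugeConfig 3 1 SU2 → ℝ, IsRawVacuum (L := 1) (oneSiteCoupling β L) e₀ →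
            let sF := slabCorr β φ (fun i => flowLiftAt (L := L) 0 (flowTime β L) (g i))
            let sO := slabCorr (oneSiteCoupling β L) e₀ (fun i => g i ∘ powLink L)
            let m := dressSteps L
            ∃ M0 : ℕ, ∀ M : ℕ, M0 ≤ M →
              ∀ i l : Fin k, i ≠ l →
                |sF (2 * m) i l M * (Real.sqrt (sO (2 * m) i i M) * Real.sqrt (sO (2 * m) l l M)) -
                    sO (2 * m) i l M * (Real.sqrt (sF (2 * m) i i M) * Real.sqrt (sF (2 * m) l l M))|
                  ≤ C * luscherLambda β L *
                      (Real.sqrt (sF (2 * m) i i M) * Real.sqrt (sF (2 * m) l l M)) *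
                        (Real.sqrt (sO (2 * m) i i M) * Real.sqrt (sO (2 * m) l l M))

/-- ★★ **`SlabGramUniversalityAt k → EuclideanGramUniversalityAt k`** (same `C`, same `lam0`): pass to the limit `M → ∞` in (E2) (`tendsto_slabCorr`; both sides
of the inequality are continuous in the six slab ratios involved). [cite: SeilerLNP1982, §3] -/
theorem euclideanGramUniversality_of_slab {k : ℕ} (h : SlabGramUniversalityAt k) : EuclideanGramUniversalityAt k := by
  obtain ⟨C, lam0, hC, hlam0, hk⟩ := h
  refine ⟨C, lam0, hC, hlam0, fun lam hlam hle => ?_⟩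
  obtain ⟨L0, hL⟩ := hk lam hlam hle
  refine ⟨L0, fun L _ hL0 β hW φ hφ ω g hbasis e₀ he₀ i l hil => ?_⟩
  obtain ⟨M0, hM⟩ := hL L hL0 β hW φ hφ ω g hbasis e₀ he₀
  have hβ : 0 < β := zero_lt_one.trans_le hW.1
  have hΛpos : 0 < luscherLambda β L := luscherLambda_pos_of_window hlam hW
  have hLr : (0 : ℝ) < L := Nat.cast_pos.mpr (NeZero.pos L)
  have hBpos : 0 < oneSiteCoupling β L := by
    unfold oneSiteCoupling; exact div_pos (mul_pos two_pos (pow_pos hLr 3)) (pow_pos hΛpos 3)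
  set m := dressSteps L with hm
  set G : Fin k → (GaugeConfig 3 L SU2 → ℝ) := fun i => flowLiftAt (L := L) 0 (flowTime β L) (g i) with hG
  set S : Fin k → (GaugeConfig 3 1 SU2 → ℝ) := fun i => g i ∘ powLink L with hS
  have hg : ∀ i, IsPhys (g i) := hbasis.2.2.2.2.1
  have hGi : ∀ i, IsPhys (G i) := fun i => isPhys_flowLiftAt 0 _ (hg i)
  have hSi : ∀ i, IsPhys (S i) := fun i => isPhys_comp_powLink L (hg i)
  have TF : ∀ (t : ℕ) (i l : Fin k), Tendsto (slabCorr β φ G t i l) atTop (𝓝 (corr β φ G t i l)) :=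
    fun t i l => tendsto_slabCorr hβ.le hφ hGi t i l
  have TO : ∀ (t : ℕ) (i l : Fin k),
      Tendsto (slabCorr (oneSiteCoupling β L) e₀ S t i l) atTop (𝓝 (corr (oneSiteCoupling β L) e₀ S t i l)) :=
    fun t i l => tendsto_slabCorr hBpos.le he₀ hSi t i l
  have TsF : Tendsto (fun M => Real.sqrt (slabCorr β φ G (2 * m) i i M) * Real.sqrt (slabCorr β φ G (2 * m) l l M)) atTop
      (𝓝 (Real.sqrt (corr β φ G (2 * m) i i) * Real.sqrt (corr β φ G (2 * m) l l))) :=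
    (TF _ i i).sqrt.mul (TF _ l l).sqrt
  have TsO : Tendsto (fun M => Real.sqrt (slabCorr (oneSiteCoupling β L) e₀ S (2 * m) i i M) *
        Real.sqrt (slabCorr (oneSiteCoupling β L) e₀ S (2 * m) l l M)) atTop
      (𝓝 (Real.sqrt (corr (oneSiteCoupling β L) e₀ S (2 * m) i i) * Real.sqrt (corr (oneSiteCoupling β L) e₀ S (2 * m) l l))) :=
    (TO _ i i).sqrt.mul (TO _ l l).sqrt
  have hev : ∀ᶠ M in atTop, M0 ≤ M := eventually_ge_atTop M0
  refine le_of_tendsto_of_tendsto ((((TF _ i l).mul TsO).sub ((TO _ i l).mul TsF)).abs) ((TsF.const_mul _).mul TsO) ?_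
  exact hev.mono fun M hMM => hM M hMM i l hil

/-- ★ **`SlabGramUniversalityAt k → GramUniversalityAt k`** — S-STAT's RG core (A2) from the finite-slab statement. [cite: LuscherWolff1990] -/
theorem gramUniversality_of_slab {k : ℕ} (h : SlabGramUniversalityAt k) : GramUniversalityAt k :=
  gramUniversality_of_euclidean (euclideanGramUniversality_of_slab h)

/-- ★ **S-STAT from the two currencies of record**: the finite-slab RG statement (A2) at every level and the one-site Gram lemma (o2′) at every level give the
registered text `LiftStaticsR3` (`liftStaticsR3_of_gramUniversality_pscalingGram`). [cite: LuscherWolff1990] [cite: Luscher1983, §3] -/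
theorem liftStaticsR3_of_slabGramUniversality_pscalingGram (hA : ∀ k, SlabGramUniversalityAt k) (hB : ∀ k, PScalingGramAt k) : LiftStaticsR3 :=
  liftStaticsR3_of_gramUniversality_pscalingGram (fun k => gramUniversality_of_slab (hA k)) hB

end Summit.QuantumFields.YangMills.Theorems.FemtoTransferGap.PolyakovLift

end
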